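import Summits.QuantumFields.YangMills.Theorems.AllWindowsColdBoxBoxHighLineConnectedThreePointRowsTiltU
import Summits.QuantumFields.YangMills.Theorems.AllWindowsColdBoxBoxHighLineK3PrimeRowSumRows

/-!
# U5 K3′ — the ROW SUM: `hK3` of ✓`landauThirdOrder_of_sizes₂` from the K3′ term table, GENERIC in the open rows
# (planner ym-idea-2 g18 routing 2026-08-30T01:02:42Z «K3′-SPLIT skeleton + hK3 row-sum in hKk currency with E1/E2/K3′(a)-sums as NAMED HYPOTHESES → fcl-p3 g27»;
# interface of record = w2 g33's `hK3` of ✓p753567; K3′ term table = HOME bus 2026-08-30T01:19:30Z (Q8 answer); LINE-20 U5 ⟨stmt-QuantumFields-24336⟩ — U5 prep, helper-grade)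

Free-hands helper of the κ-lineage (ym-line-fcl-p3 g27), the κ₃ twin of w4 g30's ✓`tiltCum4_cutSet_size_of_rows` (`…K4PrimeRowSum`).  The size `hK3` of the third cumulant
`κ₃,₀^{μ_D}(c_x, c_y; tiltU)` on every admissible symmetric cut set `D`, in the currency of ✓`landauThirdOrder_of_sizes₂ (hK3) (hK4)`, is the SUM of the rows of the K3′ term table
once the composition ✓`GaussNormalForm.abs_tiltCum3_muSet_tiltU_le_rows` (`…ConnectedThreePointRowsTiltU`: trilinear split + parity zeros, rows₂) has split `κ₃,₀` into
E1 `κ₃(L_x,L_y;Ve)` + E2 `[κ₃(C_x,L_y;P) + κ₃(L_x,C_y;P)]` + RA `κ₃(L_x,L_y;Uᵉ−Ve)` + RB `[κ₃(Q_x,c_y;Uᵉ) + κ₃(L_x,Q_y;Uᵉ)]` + RC `[κ₃(cᵉ_x,cᵒ_y;N) + κ₃(cᵒ_x,cᵉ_y;N)]`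
+ RD `[κ₃(cᵒ_x−C_x,L_y;P) + κ₃(L_x,cᵒ_y−C_y;P)]` + RE `[κ₃(cᵒ_x,Q_y−cᵒ_y;P) + κ₃(Q_x−cᵒ_x,cᵒ_y;P)]`.  This file is the BOOKKEEPING of that sum (the rows
already by name — E1-ghost, E1-Haar, E2 — live in the companion ✓`…K3PrimeRowSumRows`: `K3RowSum.rowBound_E1_ghostM/_E1_haar/_E2`, `exists_bound_quadVal_smallField`):

* ★★ `tiltCum3_cutSet_size_of_rows (Vr) (mVr) (bVr) (hE1r) (hRA) (hRB) (hRC) (hRD) (hRE) : <w2's hK3 VERBATIM>` — with `Ve := quadVal (ghostM H) + quadVal (−(1/3)•1) + Vr β H`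
  (`Vr` = the remainder even-vertex candidate, GENERIC: the quartic forms of w3 g42's E1 chain and `−β·phiQuartic` once typed), `q := max qᵢ`, `K := Σ Kᵢ`, `ε/16` budgets; the record tensors
  `Tc` (✓`K4RowSum.exists_tripleCoeff_record`, «P first») and `T₀` (✓7a `wilsonPlaquetteTaylor` at the plane `(1,2)`) are obtained inside and the cubic rows specialised to them.
  OPEN ROWS (named hypotheses; owners per planner g18 01:19:49Z / g19 01:33:25Z, Q8 table of record 01:19:30Z): hE1r (w3 g42 E1-Wilson-quartic + w2 g33 E1-Φ),
  hRA (even tail: needs 7a⁽⁴⁾/(K7) and 7d⁽⁴⁾ — LEAD/w4), hRB, hRC, hRD, hRE (Hölder/sup rows over the 13K letters — fcl-p3 lineage).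

No definitions; tree only; standard axioms.  HONEST LABEL: CONDITIONAL bookkeeping (helper-grade prep) for the UNSTAFFED stub U5 — `hK3` is NOT proved here (rows E1r, RA, RB, RC, RD, RE are
hypotheses); U5 `stub_landauThirdOrder`, ⟨24336⟩, ⟨24004⟩ remain OPEN; route AllWindowsColdBox is DRAFT; no crux, rung or summit is proved; **the Yang–Mills mass gap is NOT proved by
this file; no summit is proved by a line.**
-/

set_option autoImplicit false

noncomputable section

open MeasureTheory

open Literature.Probability.LatticeModels (Site)
open Literature.MathematicalPhysics.QuantumLattice (ZdPlaquette plaquettesTouching)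
open Literature.MathematicalPhysics.QuantumFieldTheory.AxialGauge (boxEdges)
open Summit.QuantumFields.YangMills.Theorems.WeakCouplingRates (plaq12At)

namespace Summit.QuantumFields.YangMills.Theorems.AllWindowsColdBoxBoxHighLine

open K3RowSum K4RowSum ErrorBudget in

/-- ★★ **`hK3` OF ✓`landauThirdOrder_of_sizes₂` AS THE SUM OF THE K3′ ROWS** (planner ym-idea-2 g18 routing 2026-08-30T01:02:42Z; the κ₃ twin of w4 g30's
✓`tiltCum4_cutSet_size_of_rows`).  Parameter: a REMAINDER even-vertex candidate `Vr β H` (measurable, bounded on every small-field box) — the even vertex fed to the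
composition is `Ve := quadVal (ghostM H) + quadVal (−(1/3)•1) + Vr β H`, whose two quadratic pieces are discharged HERE BY NAME (`rowBound_E1_ghostM`, `rowBound_E1_haar`,
from w5 g24's ✓`…K3PrimeRowQuad` over fcl-p3's K3′(a) ✓p753741); the assembler takes `Vr :=` the quartic polynomial vertices (`−β·Σ_p Q⁴_p` of w3 g42's E1 chain, `−β·phiQuartic`).
Hypotheses, each for every `0 < θ < 1/10` in the per-row `hKk` currency (bound `Kᵢ β H` on every admissible symmetric cut set at the point of record with co-mass demand
`qᵢ`, and `β²H⁸·Kᵢ → 0` on the top slab); the rows with cubic letters are quantified over the record tensors FIXED OUTSIDE `∃ q K` (`Tc` bounded with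
`|cubicVertex + P| ≤ Cr·β·H⁴·s⁵` — LEAD's «P first» sign, ✓`K4RowSum.exists_tripleCoeff_record` — and the local cubic Taylor tensor `T₀` of the `(1,2)`-plane with
`|c^{odd} − tripleForm T₀ (plaqVar)| ≤ C₀·t⁵` on `‖plaqVar‖ ≤ t ≤ 1`, ✓7a):
`hE1r` = `|κ₃(Lx,Ly;Vr)|` (the quartic exact rows) — the odd exact row E2 `|κ₃(Cx,Ly;P) + κ₃(Lx,Cy;P)|` is discharged HERE BY NAME too (`rowBound_E2`, w5 g24's ✓p755159) —
`hRA` = `|κ₃(Lx,Ly;Uᵉ−Ve)|` (even tail: Wilson/Φ sextic, ghost beyond `quadVal ghostM`, Haar quartic — sup×L²), `hRB` = `|κ₃(X−Lx,Y;Uᵉ) + κ₃(Lx,Y−Ly;Uᵉ)|` (Hölder, 13K-U letters),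
`hRC` = `|κ₃(X−Xo,Yo;N) + κ₃(Xo,Y−Yo;N)|` (parity survivors of the `N`-row), `hRD` = `|κ₃(Xo−Cx,Ly;P) + κ₃(Lx,Yo−Cy;P)|` (quintic letters), `hRE` = `|κ₃(Xo,Y−Ly−Yo;P) + κ₃(X−Lx−Xo,Yo;P)|`
(TERMs = the summands of ✓`GaussNormalForm.abs_tiltCum3_muSet_tiltU_le_rows` token for token after `dsimp`).  Conclusion: w2 g33's `hK3` VERBATIM (`q := max qᵢ`, `K := Σ Kᵢ`,
`ε/16` budgets).  HONEST LABEL: CONDITIONAL bookkeeping — `hK3` is NOT proved here (six rows are hypotheses). -/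
theorem tiltCum3_cutSet_size_of_rows (Vr : ℝ → (H : ℕ) → (LandauFree H → E3) → ℝ) (mVr : ∀ (β : ℝ) (H : ℕ), Measurable (Vr β H))
    (bVr : ∀ (β : ℝ) (H : ℕ) (s : ℝ), ∃ BV : ℝ, ∀ a ∈ smallField H s, |Vr β H a| ≤ BV)
    (hE1r : ∀ θ : ℝ, 0 < θ → θ < 1 / 10 → ∃ q : ℝ, ∃ K : ℝ → ℕ → ℝ,
      (∃ β₀ : ℝ, 1 ≤ β₀ ∧ ∀ β : ℝ, β₀ ≤ β → ∀ H : ℕ, 1 ≤ H → β ^ θ ≤ (H : ℝ) → (H : ℝ) ≤ β ^ θ + 1 →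
        ∀ D : Set (LandauFree H → E3), MeasurableSet D → D ⊆ smallField H (β ^ ((1 / 8 - θ / 4) - 1 / 2)) → (∀ a, -a ∈ D ↔ a ∈ D) →
        gaussAvg β H (fun a => 1 - D.indicator (fun _ => (1 : ℝ)) a) ≤ β ^ (-q) →
        gaussAvg β H (fun a => 1 - D.indicator (fun _ => (1 : ℝ)) a) ≤ 1 / 2 → (∀ a ∈ D, |tiltU β H a| ≤ 2) → ∀ x y : Site 4,
        |Tilt.tiltCum3 (((volume : Measure (LandauFree H → E3)).restrict D).withDensity fun a => ENNReal.ofReal (gaussWeight β H a))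
            (Vr β H) 0 (linCurvSq H (plaq12At x)) (linCurvSq H (plaq12At y))| ≤ K β H) ∧
      (∀ ε : ℝ, 0 < ε → ∃ β₀ : ℝ, 1 ≤ β₀ ∧ ∀ β : ℝ, β₀ ≤ β → ∀ H : ℕ, 1 ≤ H → (H : ℝ) ≤ β ^ θ + 1 → β ^ 2 * (H : ℝ) ^ 8 * K β H ≤ ε))
    (hRA : ∀ θ : ℝ, 0 < θ → θ < 1 / 10 → ∃ q : ℝ, ∃ K : ℝ → ℕ → ℝ,
      (∃ β₀ : ℝ, 1 ≤ β₀ ∧ ∀ β : ℝ, β₀ ≤ β → ∀ H : ℕ, 1 ≤ H → β ^ θ ≤ (H : ℝ) → (H : ℝ) ≤ β ^ θ + 1 →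
        ∀ D : Set (LandauFree H → E3), MeasurableSet D → D ⊆ smallField H (β ^ ((1 / 8 - θ / 4) - 1 / 2)) → (∀ a, -a ∈ D ↔ a ∈ D) →
        gaussAvg β H (fun a => 1 - D.indicator (fun _ => (1 : ℝ)) a) ≤ β ^ (-q) →
        gaussAvg β H (fun a => 1 - D.indicator (fun _ => (1 : ℝ)) a) ≤ 1 / 2 → (∀ a ∈ D, |tiltU β H a| ≤ 2) → ∀ x y : Site 4,
        |Tilt.tiltCum3 (((volume : Measure (LandauFree H → E3)).restrict D).withDensity fun a => ENNReal.ofReal (gaussWeight β H a))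
            (fun a => (tiltU β H a + tiltU β H (-a)) / 2 -
              (quadVal (GhostFP.ghostM H) a + quadVal ((-(1 / 3 : ℝ)) • (1 : Matrix (LandauFree H × Fin 3) (LandauFree H × Fin 3) ℝ)) a + Vr β H a)) 0
            (linCurvSq H (plaq12At x)) (linCurvSq H (plaq12At y))| ≤ K β H) ∧
      (∀ ε : ℝ, 0 < ε → ∃ β₀ : ℝ, 1 ≤ β₀ ∧ ∀ β : ℝ, β₀ ≤ β → ∀ H : ℕ, 1 ≤ H → (H : ℝ) ≤ β ^ θ + 1 → β ^ 2 * (H : ℝ) ^ 8 * K β H ≤ ε))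
    (hRB : ∀ θ : ℝ, 0 < θ → θ < 1 / 10 → ∃ q : ℝ, ∃ K : ℝ → ℕ → ℝ,
      (∃ β₀ : ℝ, 1 ≤ β₀ ∧ ∀ β : ℝ, β₀ ≤ β → ∀ H : ℕ, 1 ≤ H → β ^ θ ≤ (H : ℝ) → (H : ℝ) ≤ β ^ θ + 1 →
        ∀ D : Set (LandauFree H → E3), MeasurableSet D → D ⊆ smallField H (β ^ ((1 / 8 - θ / 4) - 1 / 2)) → (∀ a, -a ∈ D ↔ a ∈ D) →
        gaussAvg β H (fun a => 1 - D.indicator (fun _ => (1 : ℝ)) a) ≤ β ^ (-q) →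
        gaussAvg β H (fun a => 1 - D.indicator (fun _ => (1 : ℝ)) a) ≤ 1 / 2 → (∀ a ∈ D, |tiltU β H a| ≤ 2) → ∀ x y : Site 4,
        let μD : Measure (LandauFree H → E3) := ((volume : Measure (LandauFree H → E3)).restrict D).withDensity fun a => ENNReal.ofReal (gaussWeight β H a)
        let Ue : (LandauFree H → E3) → ℝ := fun a => (tiltU β H a + tiltU β H (-a)) / 2
        |Tilt.tiltCum3 μD Ue 0 (fun a => chartPlaqCost H x 1 2 a - linCurvSq H (plaq12At x) a) (chartPlaqCost H y 1 2) +
            Tilt.tiltCum3 μD Ue 0 (linCurvSq H (plaq12At x)) (fun a => chartPlaqCost H y 1 2 a - linCurvSq H (plaq12At y) a)| ≤ K β H) ∧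
      (∀ ε : ℝ, 0 < ε → ∃ β₀ : ℝ, 1 ≤ β₀ ∧ ∀ β : ℝ, β₀ ≤ β → ∀ H : ℕ, 1 ≤ H → (H : ℝ) ≤ β ^ θ + 1 → β ^ 2 * (H : ℝ) ^ 8 * K β H ≤ ε))
    (hRC : ∀ θ : ℝ, 0 < θ → θ < 1 / 10 → ∀ B Cr : ℝ, ∀ Tc : ZdPlaquette 4 → Fin 4 → Fin 4 → Fin 4 → ℝ, (∀ p i j k, |Tc p i j k| ≤ B) →
      (∀ H : ℕ, 1 ≤ H → ∀ β : ℝ, 0 < β → ∀ s : ℝ, 0 ≤ s → ∀ a ∈ smallField H s,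
        |cubicVertex β H a + β * ∑ p ∈ plaquettesTouching (boxEdges 4 (2 * H + 1)), tripleForm (Tc p) (plaqVar H p.1 p.2.1.1 p.2.1.2 a)| ≤
          Cr * β * (H : ℝ) ^ 4 * s ^ 5) →
      ∀ B₀ C₀ : ℝ, ∀ T₀ : Fin 4 → Fin 4 → Fin 4 → ℝ, (∀ i j k, |T₀ i j k| ≤ B₀) →
      (∀ (H : ℕ) (x : Site 4) (t : ℝ) (a : LandauFree H → E3), 0 ≤ t → t ≤ 1 → (∀ i, ‖plaqVar H x 1 2 a i‖ ≤ t) →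
        |chartPlaqCostOdd H x 1 2 a - tripleForm T₀ (plaqVar H x 1 2 a)| ≤ C₀ * t ^ 5) →
      ∃ q : ℝ, ∃ K : ℝ → ℕ → ℝ,
      (∃ β₀ : ℝ, 1 ≤ β₀ ∧ ∀ β : ℝ, β₀ ≤ β → ∀ H : ℕ, 1 ≤ H → β ^ θ ≤ (H : ℝ) → (H : ℝ) ≤ β ^ θ + 1 →
        ∀ D : Set (LandauFree H → E3), MeasurableSet D → D ⊆ smallField H (β ^ ((1 / 8 - θ / 4) - 1 / 2)) → (∀ a, -a ∈ D ↔ a ∈ D) →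
        gaussAvg β H (fun a => 1 - D.indicator (fun _ => (1 : ℝ)) a) ≤ β ^ (-q) →
        gaussAvg β H (fun a => 1 - D.indicator (fun _ => (1 : ℝ)) a) ≤ 1 / 2 → (∀ a ∈ D, |tiltU β H a| ≤ 2) → ∀ x y : Site 4,
        let μD : Measure (LandauFree H → E3) := ((volume : Measure (LandauFree H → E3)).restrict D).withDensity fun a => ENNReal.ofReal (gaussWeight β H a)
        let P : (LandauFree H → E3) → ℝ := fun a => β * ∑ p ∈ plaquettesTouching (boxEdges 4 (2 * H + 1)), tripleForm (Tc p) (plaqVar H p.1 p.2.1.1 p.2.1.2 a)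
        let N : (LandauFree H → E3) → ℝ := fun a => (tiltU β H a - tiltU β H (-a)) / 2 - P a
        |Tilt.tiltCum3 μD N 0 (fun a => chartPlaqCost H x 1 2 a - chartPlaqCostOdd H x 1 2 a) (chartPlaqCostOdd H y 1 2) +
            Tilt.tiltCum3 μD N 0 (chartPlaqCostOdd H x 1 2) (fun a => chartPlaqCost H y 1 2 a - chartPlaqCostOdd H y 1 2 a)| ≤ K β H) ∧
      (∀ ε : ℝ, 0 < ε → ∃ β₀ : ℝ, 1 ≤ β₀ ∧ ∀ β : ℝ, β₀ ≤ β → ∀ H : ℕ, 1 ≤ H → (H : ℝ) ≤ β ^ θ + 1 → β ^ 2 * (H : ℝ) ^ 8 * K β H ≤ ε))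
    (hRD : ∀ θ : ℝ, 0 < θ → θ < 1 / 10 → ∀ B Cr : ℝ, ∀ Tc : ZdPlaquette 4 → Fin 4 → Fin 4 → Fin 4 → ℝ, (∀ p i j k, |Tc p i j k| ≤ B) →
      (∀ H : ℕ, 1 ≤ H → ∀ β : ℝ, 0 < β → ∀ s : ℝ, 0 ≤ s → ∀ a ∈ smallField H s,
        |cubicVertex β H a + β * ∑ p ∈ plaquettesTouching (boxEdges 4 (2 * H + 1)), tripleForm (Tc p) (plaqVar H p.1 p.2.1.1 p.2.1.2 a)| ≤
          Cr * β * (H : ℝ) ^ 4 * s ^ 5) →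
      ∀ B₀ C₀ : ℝ, ∀ T₀ : Fin 4 → Fin 4 → Fin 4 → ℝ, (∀ i j k, |T₀ i j k| ≤ B₀) →
      (∀ (H : ℕ) (x : Site 4) (t : ℝ) (a : LandauFree H → E3), 0 ≤ t → t ≤ 1 → (∀ i, ‖plaqVar H x 1 2 a i‖ ≤ t) →
        |chartPlaqCostOdd H x 1 2 a - tripleForm T₀ (plaqVar H x 1 2 a)| ≤ C₀ * t ^ 5) →
      ∃ q : ℝ, ∃ K : ℝ → ℕ → ℝ,
      (∃ β₀ : ℝ, 1 ≤ β₀ ∧ ∀ β : ℝ, β₀ ≤ β → ∀ H : ℕ, 1 ≤ H → β ^ θ ≤ (H : ℝ) → (H : ℝ) ≤ β ^ θ + 1 →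
        ∀ D : Set (LandauFree H → E3), MeasurableSet D → D ⊆ smallField H (β ^ ((1 / 8 - θ / 4) - 1 / 2)) → (∀ a, -a ∈ D ↔ a ∈ D) →
        gaussAvg β H (fun a => 1 - D.indicator (fun _ => (1 : ℝ)) a) ≤ β ^ (-q) →
        gaussAvg β H (fun a => 1 - D.indicator (fun _ => (1 : ℝ)) a) ≤ 1 / 2 → (∀ a ∈ D, |tiltU β H a| ≤ 2) → ∀ x y : Site 4,
        let μD : Measure (LandauFree H → E3) := ((volume : Measure (LandauFree H → E3)).restrict D).withDensity fun a => ENNReal.ofReal (gaussWeight β H a)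
        let P : (LandauFree H → E3) → ℝ := fun a => β * ∑ p ∈ plaquettesTouching (boxEdges 4 (2 * H + 1)), tripleForm (Tc p) (plaqVar H p.1 p.2.1.1 p.2.1.2 a)
        |Tilt.tiltCum3 μD P 0 (fun a => chartPlaqCostOdd H x 1 2 a - tripleForm T₀ (plaqVar H x 1 2 a)) (linCurvSq H (plaq12At y)) +
            Tilt.tiltCum3 μD P 0 (linCurvSq H (plaq12At x)) (fun a => chartPlaqCostOdd H y 1 2 a - tripleForm T₀ (plaqVar H y 1 2 a))| ≤ K β H) ∧
      (∀ ε : ℝ, 0 < ε → ∃ β₀ : ℝ, 1 ≤ β₀ ∧ ∀ β : ℝ, β₀ ≤ β → ∀ H : ℕ, 1 ≤ H → (H : ℝ) ≤ β ^ θ + 1 → β ^ 2 * (H : ℝ) ^ 8 * K β H ≤ ε))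
    (hRE : ∀ θ : ℝ, 0 < θ → θ < 1 / 10 → ∀ B Cr : ℝ, ∀ Tc : ZdPlaquette 4 → Fin 4 → Fin 4 → Fin 4 → ℝ, (∀ p i j k, |Tc p i j k| ≤ B) →
      (∀ H : ℕ, 1 ≤ H → ∀ β : ℝ, 0 < β → ∀ s : ℝ, 0 ≤ s → ∀ a ∈ smallField H s,
        |cubicVertex β H a + β * ∑ p ∈ plaquettesTouching (boxEdges 4 (2 * H + 1)), tripleForm (Tc p) (plaqVar H p.1 p.2.1.1 p.2.1.2 a)| ≤
          Cr * β * (H : ℝ) ^ 4 * s ^ 5) →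
      ∀ B₀ C₀ : ℝ, ∀ T₀ : Fin 4 → Fin 4 → Fin 4 → ℝ, (∀ i j k, |T₀ i j k| ≤ B₀) →
      (∀ (H : ℕ) (x : Site 4) (t : ℝ) (a : LandauFree H → E3), 0 ≤ t → t ≤ 1 → (∀ i, ‖plaqVar H x 1 2 a i‖ ≤ t) →
        |chartPlaqCostOdd H x 1 2 a - tripleForm T₀ (plaqVar H x 1 2 a)| ≤ C₀ * t ^ 5) →
      ∃ q : ℝ, ∃ K : ℝ → ℕ → ℝ,
      (∃ β₀ : ℝ, 1 ≤ β₀ ∧ ∀ β : ℝ, β₀ ≤ β → ∀ H : ℕ, 1 ≤ H → β ^ θ ≤ (H : ℝ) → (H : ℝ) ≤ β ^ θ + 1 →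
        ∀ D : Set (LandauFree H → E3), MeasurableSet D → D ⊆ smallField H (β ^ ((1 / 8 - θ / 4) - 1 / 2)) → (∀ a, -a ∈ D ↔ a ∈ D) →
        gaussAvg β H (fun a => 1 - D.indicator (fun _ => (1 : ℝ)) a) ≤ β ^ (-q) →
        gaussAvg β H (fun a => 1 - D.indicator (fun _ => (1 : ℝ)) a) ≤ 1 / 2 → (∀ a ∈ D, |tiltU β H a| ≤ 2) → ∀ x y : Site 4,
        let μD : Measure (LandauFree H → E3) := ((volume : Measure (LandauFree H → E3)).restrict D).withDensity fun a => ENNReal.ofReal (gaussWeight β H a)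
        let P : (LandauFree H → E3) → ℝ := fun a => β * ∑ p ∈ plaquettesTouching (boxEdges 4 (2 * H + 1)), tripleForm (Tc p) (plaqVar H p.1 p.2.1.1 p.2.1.2 a)
        |Tilt.tiltCum3 μD P 0 (chartPlaqCostOdd H x 1 2) (fun a => chartPlaqCost H y 1 2 a - linCurvSq H (plaq12At y) a - chartPlaqCostOdd H y 1 2 a) +
            Tilt.tiltCum3 μD P 0 (fun a => chartPlaqCost H x 1 2 a - linCurvSq H (plaq12At x) a - chartPlaqCostOdd H x 1 2 a) (chartPlaqCostOdd H y 1 2)| ≤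
          K β H) ∧
      (∀ ε : ℝ, 0 < ε → ∃ β₀ : ℝ, 1 ≤ β₀ ∧ ∀ β : ℝ, β₀ ≤ β → ∀ H : ℕ, 1 ≤ H → (H : ℝ) ≤ β ^ θ + 1 → β ^ 2 * (H : ℝ) ^ 8 * K β H ≤ ε)) :
    ∀ θ : ℝ, 0 < θ → θ < 1 / 10 → ∃ q : ℝ, ∃ K : ℝ → ℕ → ℝ,
      (∃ β₀ : ℝ, 1 ≤ β₀ ∧ ∀ β : ℝ, β₀ ≤ β → ∀ H : ℕ, 1 ≤ H → β ^ θ ≤ (H : ℝ) → (H : ℝ) ≤ β ^ θ + 1 →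
        ∀ D : Set (LandauFree H → E3), MeasurableSet D → D ⊆ smallField H (β ^ ((1 / 8 - θ / 4) - 1 / 2)) → (∀ a, -a ∈ D ↔ a ∈ D) →
        gaussAvg β H (fun a => 1 - D.indicator (fun _ => (1 : ℝ)) a) ≤ β ^ (-q) →
        gaussAvg β H (fun a => 1 - D.indicator (fun _ => (1 : ℝ)) a) ≤ 1 / 2 → (∀ a ∈ D, |tiltU β H a| ≤ 2) → ∀ x y : Site 4,
        |Tilt.tiltCum3 (((volume : Measure (LandauFree H → E3)).restrict D).withDensity fun a => ENNReal.ofReal (gaussWeight β H a))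
            (tiltU β H) 0 (chartPlaqCost H x 1 2) (chartPlaqCost H y 1 2)| ≤ K β H) ∧
      (∀ ε : ℝ, 0 < ε → ∃ β₀ : ℝ, 1 ≤ β₀ ∧ ∀ β : ℝ, β₀ ≤ β → ∀ H : ℕ, 1 ≤ H → (H : ℝ) ≤ β ^ θ + 1 → β ^ 2 * (H : ℝ) ^ 8 * K β H ≤ ε) := by
  intro θ hθ hθ'
  -- the record tensors: the cubic vertex coefficients («P first») and the local cubic Taylor tensor of the (1,2)-plane (✓7a)
  obtain ⟨B, Cr, -, -, Tc, hTc, hrem⟩ := exists_tripleCoeff_record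
  obtain ⟨C7, h7⟩ := wilsonPlaquetteTaylor
  obtain ⟨T₀, hT₀, h7'⟩ := h7 1 2 (by decide)
  have hrec₀ : ∀ (H : ℕ) (x : Site 4) (t : ℝ) (a : LandauFree H → E3), 0 ≤ t → t ≤ 1 → (∀ i, ‖plaqVar H x 1 2 a i‖ ≤ t) →
      |chartPlaqCostOdd H x 1 2 a - tripleForm T₀ (plaqVar H x 1 2 a)| ≤ C7 * t ^ 5 := fun H x t a ht0 ht1 hv => (h7' H x t a ht0 ht1 hv).2
  -- the nine rows at this `θ` (E1 = ghost + Haar by name + the generic remainder vertex `Vr`)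
  obtain ⟨p₁, J₁, hA₁, hT₁⟩ := rowBound_E1_ghostM θ hθ hθ'
  obtain ⟨p₂, J₂, hA₂, hT₂⟩ := rowBound_E1_haar θ hθ hθ'
  obtain ⟨q₁, K₁, hB₁, hS₁⟩ := hE1r θ hθ hθ'
  obtain ⟨q₂, K₂, hB₂, hS₂⟩ := rowBound_E2 θ hθ hθ' B Cr Tc hTc hrem C7 C7 T₀ hT₀ hrec₀
  obtain ⟨q₃, K₃, hB₃, hS₃⟩ := hRA θ hθ hθ'
  obtain ⟨q₄, K₄, hB₄, hS₄⟩ := hRB θ hθ hθ'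
  obtain ⟨q₅, K₅, hB₅, hS₅⟩ := hRC θ hθ hθ' B Cr Tc hTc hrem C7 C7 T₀ hT₀ hrec₀
  obtain ⟨q₆, K₆, hB₆, hS₆⟩ := hRD θ hθ hθ' B Cr Tc hTc hrem C7 C7 T₀ hT₀ hrec₀
  obtain ⟨q₇, K₇, hB₇, hS₇⟩ := hRE θ hθ hθ' B Cr Tc hTc hrem C7 C7 T₀ hT₀ hrec₀
  set q' : ℝ := max (max (max q₁ q₂) (max q₃ q₄)) (max (max q₅ q₆) q₇) with hq'def
  set q : ℝ := max q' (max p₁ p₂) with hqdef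
  have hq'q : q' ≤ q := le_max_left _ _
  have hp₁ : p₁ ≤ q := (le_max_left _ _).trans (le_max_right _ _)
  have hp₂ : p₂ ≤ q := (le_max_right _ _).trans (le_max_right _ _)
  have hq₁ : q₁ ≤ q := ((le_max_left _ _).trans ((le_max_left _ _).trans (le_max_left _ _))).trans hq'q
  have hq₂ : q₂ ≤ q := ((le_max_right _ _).trans ((le_max_left _ _).trans (le_max_left _ _))).trans hq'q
  have hq₃ : q₃ ≤ q := ((le_max_left _ _).trans ((le_max_right _ _).trans (le_max_left _ _))).trans hq'q
  have hq₄ : q₄ ≤ q := ((le_max_right _ _).trans ((le_max_right _ _).trans (le_max_left _ _))).trans hq'q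
  have hq₅ : q₅ ≤ q := ((le_max_left _ _).trans ((le_max_left _ _).trans (le_max_right _ _))).trans hq'q
  have hq₆ : q₆ ≤ q := ((le_max_right _ _).trans ((le_max_left _ _).trans (le_max_right _ _))).trans hq'q
  have hq₇ : q₇ ≤ q := ((le_max_right _ _).trans (le_max_right _ _)).trans hq'q
  refine ⟨q, fun β H => J₁ β H + J₂ β H + K₁ β H + K₂ β H + K₃ β H + K₄ β H + K₅ β H + K₆ β H + K₇ β H, ?_, ?_⟩
  · -- the bound on every admissible cut set
    obtain ⟨β₀, hβ₀, hall⟩ := exists_forall_and hA₁ (exists_forall_and hA₂ (exists_forall_and hB₁ (exists_forall_and hB₂ (exists_forall_and hB₃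
      (exists_forall_and hB₄ (exists_forall_and hB₅ (exists_forall_and hB₆ hB₇)))))))
    refine ⟨β₀, hβ₀, fun β hβ H hH hHl hHu D hDm hDs hsym hco hco2 hU x y => ?_⟩
    obtain ⟨s₁, s₂, r₁, r₂, r₃, r₄, r₅, r₆, r₇⟩ := hall β hβ H
    have hβ1 : 1 ≤ β := hβ₀.trans hβ
    have hβ0 : 0 < β := by linarith
    have hmono : ∀ {q' : ℝ}, q' ≤ q → gaussAvg β H (fun a => 1 - D.indicator (fun _ => (1 : ℝ)) a) ≤ β ^ (-q') :=
      fun hq' => hco.trans (Real.rpow_le_rpow_of_exponent_le hβ1 (neg_le_neg hq'))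
    replace s₁ := s₁ hH hHl hHu D hDm hDs hsym (hmono hp₁) hco2 hU x y
    replace s₂ := s₂ hH hHl hHu D hDm hDs hsym (hmono hp₂) hco2 hU x y
    replace r₁ := r₁ hH hHl hHu D hDm hDs hsym (hmono hq₁) hco2 hU x y
    replace r₂ := r₂ hH hHl hHu D hDm hDs hsym (hmono hq₂) hco2 hU x y
    replace r₃ := r₃ hH hHl hHu D hDm hDs hsym (hmono hq₃) hco2 hU x y
    replace r₄ := r₄ hH hHl hHu D hDm hDs hsym (hmono hq₄) hco2 hU x y
    replace r₅ := r₅ hH hHl hHu D hDm hDs hsym (hmono hq₅) hco2 hU x y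
    replace r₆ := r₆ hH hHl hHu D hDm hDs hsym (hmono hq₆) hco2 hU x y
    replace r₇ := r₇ hH hHl hHu D hDm hDs hsym (hmono hq₇) hco2 hU x y
    have hs0 : 0 ≤ β ^ ((1 / 8 - θ / 4) - 1 / 2) := Real.rpow_nonneg hβ0.le _
    have hs1 : β ^ ((1 / 8 - θ / 4) - 1 / 2) ≤ 1 := Real.rpow_le_one_of_one_le_of_nonpos hβ1 (by linarith)
    -- the even vertex of record modulo the generic remainder `Vr`, its measurability and a bound on `D`
    set M₁ : Matrix (LandauFree H × Fin 3) (LandauFree H × Fin 3) ℝ := GhostFP.ghostM H with hM₁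
    set M₂ : Matrix (LandauFree H × Fin 3) (LandauFree H × Fin 3) ℝ := (-(1 / 3 : ℝ)) • (1 : Matrix (LandauFree H × Fin 3) (LandauFree H × Fin 3) ℝ)
      with hM₂
    obtain ⟨B₁, hBV₁⟩ := exists_bound_quadVal_smallField H M₁ (β ^ ((1 / 8 - θ / 4) - 1 / 2))
    obtain ⟨B₂, hBV₂⟩ := exists_bound_quadVal_smallField H M₂ (β ^ ((1 / 8 - θ / 4) - 1 / 2))
    obtain ⟨B₃, hBV₃⟩ := bVr β H (β ^ ((1 / 8 - θ / 4) - 1 / 2))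
    set BV : ℝ := |B₁| + |B₂| + |B₃| with hBVdef
    have hb₁ : ∀ a ∈ D, |quadVal M₁ a| ≤ BV := fun a ha => ((hBV₁ a (hDs ha)).trans (le_abs_self _)).trans (by
      rw [hBVdef]; linarith [abs_nonneg B₂, abs_nonneg B₃])
    have hb₂ : ∀ a ∈ D, |quadVal M₂ a| ≤ BV := fun a ha => ((hBV₂ a (hDs ha)).trans (le_abs_self _)).trans (by
      rw [hBVdef]; linarith [abs_nonneg B₁, abs_nonneg B₃])
    have hb₃ : ∀ a ∈ D, |Vr β H a| ≤ BV := fun a ha => ((hBV₃ a (hDs ha)).trans (le_abs_self _)).trans (by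
      rw [hBVdef]; linarith [abs_nonneg B₁, abs_nonneg B₂])
    have hb₁₂ : ∀ a ∈ D, |quadVal M₁ a + quadVal M₂ a| ≤ 2 * BV := fun a ha => by
      linarith [abs_add_le (quadVal M₁ a) (quadVal M₂ a), hb₁ a ha, hb₂ a ha]
    have hb₃' : ∀ a ∈ D, |Vr β H a| ≤ 2 * BV := fun a ha => (hb₃ a ha).trans (by linarith [(abs_nonneg _).trans (hb₃ a ha)])
    have hbV : ∀ a ∈ D, |quadVal M₁ a + quadVal M₂ a + Vr β H a| ≤ 3 * BV := fun a ha => by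
      linarith [abs_add_le (quadVal M₁ a + quadVal M₂ a) (Vr β H a), hb₁₂ a ha, hb₃ a ha]
    have m₁ : Measurable (quadVal M₁ : (LandauFree H → E3) → ℝ) := GaussRestrict.measurable_quadVal M₁
    have m₂ : Measurable (quadVal M₂ : (LandauFree H → E3) → ℝ) := GaussRestrict.measurable_quadVal M₂
    have m₁₂ : Measurable fun a : LandauFree H → E3 => quadVal M₁ a + quadVal M₂ a := m₁.add m₂
    have mV : Measurable fun a : LandauFree H → E3 => quadVal M₁ a + quadVal M₂ a + Vr β H a := m₁₂.add (mVr β H)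
    -- the composition (rows₂ in the letters of record), by name
    have hsp := GaussNormalForm.abs_tiltCum3_muSet_tiltU_le_rows H hβ0 hs0 hs1 B Tc hTc C7 T₀ T₀ hT₀ hT₀ hDm hDs hsym mV hbV
      (by norm_num : (0 : ℝ) ≤ 2) hU hco2 le_rfl x y
    -- the E1 row, vertex by vertex
    have hE1a := GaussNormalForm.abs_tiltCum3_muSet_linCurvSq_add_third_le H hβ0 hs0 hDm hDs hco2 le_rfl m₁₂ (mVr β H) hb₁₂ hb₃' x y
    have hE1b := GaussNormalForm.abs_tiltCum3_muSet_linCurvSq_add_third_le H hβ0 hs0 hDm hDs hco2 le_rfl m₁ m₂ hb₁ hb₂ x y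
    dsimp only at hsp r₂ r₄ r₅ r₆ r₇
    rw [hM₁, hM₂] at hsp hE1a hE1b
    have key : ∀ {t e e₁₂ b₁ b₂ a₁ a₂ a₃ a₄ a₅ a₆ a₇ j₁ j₂ k₁ k₂ k₃ k₄ k₅ k₆ k₇ : ℝ}, t ≤ e + a₂ + a₃ + a₄ + a₅ + a₆ + a₇ →
        e ≤ e₁₂ + a₁ → e₁₂ ≤ b₁ + b₂ → b₁ ≤ j₁ → b₂ ≤ j₂ →
        a₁ ≤ k₁ → a₂ ≤ k₂ → a₃ ≤ k₃ → a₄ ≤ k₄ → a₅ ≤ k₅ → a₆ ≤ k₆ → a₇ ≤ k₇ → t ≤ j₁ + j₂ + k₁ + k₂ + k₃ + k₄ + k₅ + k₆ + k₇ := by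
      intros; linarith
    exact key hsp hE1a hE1b s₁ s₂ r₁ r₂ r₃ r₄ r₅ r₆ r₇
  · -- the budget
    intro ε hε
    have hε' : 0 < ε / 16 := by positivity
    obtain ⟨β₀, hβ₀, hall⟩ := exists_forall_and (hT₁ _ hε') (exists_forall_and (hT₂ _ hε') (exists_forall_and (hS₁ _ hε')
      (exists_forall_and (hS₂ _ hε') (exists_forall_and (hS₃ _ hε') (exists_forall_and (hS₄ _ hε') (exists_forall_and (hS₅ _ hε')
      (exists_forall_and (hS₆ _ hε') (hS₇ _ hε'))))))))
    refine ⟨β₀, hβ₀, fun β hβ H hH hHu => ?_⟩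
    obtain ⟨d₁, d₂, e₁, e₂, e₃, e₄, e₅, e₆, e₇⟩ := hall β hβ H
    replace d₁ := d₁ hH hHu
    replace d₂ := d₂ hH hHu
    replace e₁ := e₁ hH hHu
    replace e₂ := e₂ hH hHu
    replace e₃ := e₃ hH hHu
    replace e₄ := e₄ hH hHu
    replace e₅ := e₅ hH hHu
    replace e₆ := e₆ hH hHu
    replace e₇ := e₇ hH hHu
    have hid : β ^ 2 * (H : ℝ) ^ 8 * (J₁ β H + J₂ β H + K₁ β H + K₂ β H + K₃ β H + K₄ β H + K₅ β H + K₆ β H + K₇ β H) =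
        β ^ 2 * (H : ℝ) ^ 8 * J₁ β H + β ^ 2 * (H : ℝ) ^ 8 * J₂ β H +
        (β ^ 2 * (H : ℝ) ^ 8 * K₁ β H + β ^ 2 * (H : ℝ) ^ 8 * K₂ β H + β ^ 2 * (H : ℝ) ^ 8 * K₃ β H + β ^ 2 * (H : ℝ) ^ 8 * K₄ β H +
          β ^ 2 * (H : ℝ) ^ 8 * K₅ β H + β ^ 2 * (H : ℝ) ^ 8 * K₆ β H + β ^ 2 * (H : ℝ) ^ 8 * K₇ β H) := by ring
    rw [hid]
    linarith

end Summit.QuantumFields.YangMills.Theorems.AllWindowsColdBoxBoxHighLine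

end
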